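import Summits.ResolutionOfSingularities.ResolutionOfSingularities.Theorems.EquisingularLiftEquisingularLiftNatExceptionalTraceChartAlgebra
import Summits.ResolutionOfSingularities.ResolutionOfSingularities.Theorems.EquisingularLiftEquisingularLiftNatBlowupChartPointOfPrime
import Summits.ResolutionOfSingularities.ResolutionOfSingularities.Theorems.EquisingularLiftEquisingularLiftNatDeltaCriterion
import Summits.ResolutionOfSingularities.ResolutionOfSingularities.Theorems.EquisingularLiftEquisingularLiftNatConeChart
import HarnessLib

/-!
# [OURS · L1 W4.5(b) · EL♮] T-PTPRIME-DICT (2/2): the non-regular points of the reduced exceptional trace `Z` are read on the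
# chart algebras — «finitely many non-regular points of `V(Z)_red`» ⇒ «finitely many bad primes on every chart»

Crux `EquisingularLiftNat` = stmt-ResolutionOfSingularities-20038 (route EquisingularLift), registered stub
`stub_elnat_tcDeltaPointResolution` (any `n`); helper file `--supports stmt-ResolutionOfSingularities-20038 --as helper`. Object
T-PTPRIME-DICT (res-L1-w45b-lead-2 2026-08-27T09:31:41Z; res-type-100 09:30:25Z (B)): transport the (TC) clause's hypothesis
«`Set.Finite {z : V(Z)_red | ¬ regular}`» to the per-chart finiteness of the primes of the chart algebras at which the trace is not
regular — the input `hfin` of res-type-032's `exists_isHomogeneous_lift_deltaRegular` for general `r`. HONEST FRAMING: OURS (cell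
res-hironaka, slot W4.5(b)); NOT a statement of any manuscript. AI-written, weaker than expert review. No `sorry`; standard axioms.

SETTING (= res-type-097's `stalkIdeal_vanishingIdeal_carrierTrace_of_presentation`, p-file …NatTangentConeFibreReduced, with the base
point a variable `x`): `υ : F' → F` any morphism with `F'` locally Noetherian (for the finiteness theorem: the blow-up of the closed point
`x`), `R = 𝒪_{F,x}`, `c` a quasi-regular system of generators of `𝔪_x`, `W ⊆ F` closed with `𝓘(W)_x = (Φ(c))`, `Φ` a form with
reduction `φ ≠ 0`, `G ∈ R[T]` with reduction `ḡ` such that (R1) `φ ∈ √(ḡ)`, `ḡ ∈ √(φ)` and (R2) `(ḡ(T_j := 1))` radical for all `j`,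
`Z := vanishingIdeal (υ⁻¹{x} ∩ closure υ⁻¹(W ∖ {x}))` (the reduced exceptional trace), `B_j = R[𝔪_x/c_j]` the affine blowup algebras,
`G_j := G(c/c_j) ∈ B_j`, `t_j := c_j/1 ∈ B_j`.

## Content (namespace `…Cruxes.EquisingularLiftNat.Sections`)

* `finite_badPrimes_of_finite_nonregular_carrierTrace` — **T-PTPRIME-DICT** in res-type-032's `hfin` currency: if `υ` is the
  blow-up of `x` and the reduced trace `V(Z)` has finitely many non-regular points, then for every chart `j` (with `ḡ_j ≠ 0`) the
  primes `𝔮` of `k[T_l : l ≠ j]` (`k` ANY field with a surjection `πk : 𝒪_{F,x} ↠ k` of kernel `(c)` — res-type-032's field;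
  `ḡ_j := πk (G(T_j := 1))`) with `ḡ_j ∈ 𝔮` and `ḡ_j ∈ 𝔪_𝔮²` are finitely many (injective prime ↦ point,
  `chartPrime_eq_of_presentations`; the trace local ring is `(k[T]/(ḡ_j))_𝔮` by res-type-100's `blowupAlgebraQuotEquiv` /
  `mk_coneTransform_eq` and `exists_surjective_ker_eq_of_isLocalization_comap` of file …NatExceptionalTraceChartAlgebra, which also
  carries the stalk formula `stalkIdeal_carrierTrace_of_presentation'` at presented points; (Δ1) of res-type-032 decides regularity).
DESIGN NOTE: statements never form quotients or localisations of `Localization.AtPrime 𝔔` for primes `𝔔` of the subalgebra type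
`blowupAlgebra …`, nor of `𝒪_{F,x}/(c)[T]` (both hit non-defeq instance paths); the field is an abstract `k`, which the consumer
instantiates (e.g. `k := IsLocalRing.ResidueField 𝒪_{F,x}`, `πk := IsLocalRing.residue _`, kernel `= (c)` by `hc𝔪`).

References: Stacks 0804/0805/0BIQ through the cited tree files; p506193, p509910 (res-type-100), …NatTangentConeFibreReduced (res-type-097).
-/


set_option linter.dupNamespace false -- mandated namespace `Summit.<Summit>.<Problem>` of this single-conjunct summit

noncomputable section

open CategoryTheory AlgebraicGeometry TopologicalSpace Topology IsLocalRing
open Literature.AlgebraicGeometry.Resolution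
open AlgebraicGeometry.Scheme.IdealSheafData

namespace Summit.ResolutionOfSingularities.ResolutionOfSingularities.Cruxes.EquisingularLiftNat.Sections

universe u

/-! ## The finiteness transfer, in res-type-032's `hfin` currency -/

section Finite

variable {F F' : Scheme.{u}} {υ : F' ⟶ F} {x : F}

set_option maxHeartbeats 800000 in -- long assembly; subalgebra-of-localisation instances are slow (cf. p506193, p509910)
/-- **T-PTPRIME-DICT.** Let `υ : F' → F` be the blow-up of the closed point `x` (`IsBlowup υ 𝓘_{x}`, `F'` locally Noetherian),
with the data `(c, W, Φ, G)` of the reduced exceptional trace `Z = vanishingIdeal (υ⁻¹{x} ∩ closure υ⁻¹(W ∖ {x}))` as in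
`stalkIdeal_carrierTrace_of_presentation'` (res-type-097's (R1)/(R2)), `k` a field with a surjection `πk : 𝒪_{F,x} ↠ k` of
kernel `(c)` (so `k ≅ κ(x)`), `ḡ_j := πk (dehomogenize j G) ∈ k[T_l : l ≠ j]`, `ḡ_j ≠ 0`. If the reduced closed subscheme `V(Z)` has
finitely many non-regular points, then for every chart `j` the set of primes `𝔮` of `k[T_l : l ≠ j]` with `ḡ_j ∈ 𝔮` and
`ḡ_j ∈ 𝔪_𝔮²` (in `k[T]_𝔮`) is finite — the hypothesis `hfin j` of res-type-032's `exists_isHomogeneous_lift_deltaRegular` with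
`g := MvPolynomial.map πk G` (`map_dehomogenize`). Each bad `𝔮` gives the prime `𝔔 = Θ_j⁻¹ 𝔮` of `B_j = 𝒪_{F,x}[𝔪_x/c_j]`
(`Θ_j : B_j → B_j/(t_j) ≅ k[T]` along `πk`, Stacks 0BIQ), a point `x' ∈ Z` presented at `𝔔`
(`exists_point_presentation_of_blowupAlgebra_prime`), whose trace local ring `𝒪_{V(Z),x'} ≅ 𝒪_{F',x'}/Z_{x'} ≅ (k[T]/(ḡ_j))_𝔮`
(`exists_surjective_ker_eq_of_isLocalization_comap`)
is not regular by (Δ1) (res-type-032's `isRegularLocalRing_localization_quotient_iff_notMem_sq`); injectively in `𝔮`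
(`chartPrime_eq_of_presentations`). [cite: StacksProject, Tag 0804; StacksProject, Tag 0BIQ] -/
theorem finite_badPrimes_of_finite_nonregular_carrierTrace [IsLocallyNoetherian F'] (hx : IsClosed ({x} : Set F))
    (hυ : IsBlowup υ (Scheme.IdealSheafData.vanishingIdeal ⟨{x}, hx⟩)) {r : ℕ}
    (c : Fin r → F.presheaf.stalk x) (hc𝔪 : Ideal.span (Set.range c) = maximalIdeal (F.presheaf.stalk x))
    (hc : IsQuasiRegular c) {k : Type*} [Field k] (πk : F.presheaf.stalk x →+* k) (hπk : Function.Surjective πk)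
    (hkerπ : RingHom.ker πk = Ideal.span (Set.range c)) (W : Closeds F) {d : ℕ} (Φ G : MvPolynomial (Fin r) (F.presheaf.stalk x))
    (hΦd : Φ.IsHomogeneous d) (hΦ : MvPolynomial.map (Ideal.Quotient.mk (Ideal.span (Set.range c))) Φ ≠ 0)
    (hW : stalkIdeal (Scheme.IdealSheafData.vanishingIdeal W) x = Ideal.span {MvPolynomial.eval c Φ})
    (hΦG : MvPolynomial.map (Ideal.Quotient.mk (Ideal.span (Set.range c))) Φ ∈
      (Ideal.span {MvPolynomial.map (Ideal.Quotient.mk (Ideal.span (Set.range c))) G}).radical)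
    (hGΦ : MvPolynomial.map (Ideal.Quotient.mk (Ideal.span (Set.range c))) G ∈
      (Ideal.span {MvPolynomial.map (Ideal.Quotient.mk (Ideal.span (Set.range c))) Φ}).radical)
    (hGrad : ∀ j, (Ideal.span {MvPolynomial.map (Ideal.Quotient.mk (Ideal.span (Set.range c)))
      (dehomogenize j G)}).IsRadical)
    (hZ : IsClosed (υ ⁻¹' {x} ∩ closure (υ ⁻¹' ((W : Set F) \ {x}))))
    (hfin : Set.Finite {z : ↥(Scheme.IdealSheafData.vanishingIdeal
        (⟨υ ⁻¹' {x} ∩ closure (υ ⁻¹' ((W : Set F) \ {x})), hZ⟩ : Closeds F')).subscheme |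
      ¬ IsRegularLocalRing ((Scheme.IdealSheafData.vanishingIdeal
        (⟨υ ⁻¹' {x} ∩ closure (υ ⁻¹' ((W : Set F) \ {x})), hZ⟩ : Closeds F')).subscheme.presheaf.stalk z)})
    (j : Fin r) (hGj : MvPolynomial.map πk (dehomogenize j G) ≠ 0) :
    Set.Finite {𝔮 : PrimeSpectrum (MvPolynomial {l : Fin r // l ≠ j} k) |
      MvPolynomial.map πk (dehomogenize j G) ∈ 𝔮.asIdeal ∧
      algebraMap _ (Localization.AtPrime 𝔮.asIdeal) (MvPolynomial.map πk (dehomogenize j G)) ∈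
        maximalIdeal (Localization.AtPrime 𝔮.asIdeal) ^ 2} := by
  classical
  set Zi := Scheme.IdealSheafData.vanishingIdeal
    (⟨υ ⁻¹' {x} ∩ closure (υ ⁻¹' ((W : Set F) \ {x})), hZ⟩ : Closeds F') with hZi
  set Gj : blowupAlgebra (Ideal.span (Set.range c)) (c j) := MvPolynomial.aeval (blowupAlgebra.frac c j) G with hGjdef
  set tj : blowupAlgebra (Ideal.span (Set.range c)) (c j) := algebraMap (F.presheaf.stalk x) (blowupAlgebra (Ideal.span (Set.range c)) (c j)) (c j) with htj
  set gbar : MvPolynomial {l : Fin r // l ≠ j} k := MvPolynomial.map πk (dehomogenize j G) with hgbar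
  haveI : IsDomain (MvPolynomial {l : Fin r // l ≠ j} k) := inferInstance
  haveI : IsRegularRing k := inferInstance
  haveI : IsRegularRing (MvPolynomial {l : Fin r // l ≠ j} k) := MvPolynomial.isRegularRing_of_isRegularRing _
  have hcJ : stalkIdeal (Scheme.IdealSheafData.vanishingIdeal ⟨{x}, hx⟩) x = Ideal.span (Set.range c) := by
    rw [hc𝔪, stalkIdeal_vanishingIdeal_singleton hx]
  -- `k₀ = 𝒪_{F,x}/(c) ≅ k` along `πk`
  let ek : (F.presheaf.stalk x ⧸ Ideal.span (Set.range c)) ≃+* k :=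
    (Ideal.quotEquivOfEq hkerπ.symm).trans (RingHom.quotientKerEquivOfSurjective hπk)
  have hek : ∀ a, ek (Ideal.Quotient.mk (Ideal.span (Set.range c)) a) = πk a := fun a => by
    change RingHom.quotientKerEquivOfSurjective hπk (Ideal.quotEquivOfEq hkerπ.symm (Ideal.Quotient.mk _ a)) = πk a
    rw [Ideal.quotEquivOfEq_mk, RingHom.quotientKerEquivOfSurjective_apply_mk]
  -- the chart map `Θ : B_j → B_j/(t_j) ≅ k₀[T_l : l ≠ j] ≅ k[T_l : l ≠ j]` (Stacks 0BIQ)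
  let E := blowupAlgebraQuotEquiv c j hc
  let Θ : blowupAlgebra (Ideal.span (Set.range c)) (c j) →+* MvPolynomial {l : Fin r // l ≠ j} k :=
    (MvPolynomial.map (ek : _ →+* k)).comp
      ((E.symm : _ →+* MvPolynomial {l : Fin r // l ≠ j} (F.presheaf.stalk x ⧸ Ideal.span (Set.range c))).comp
        (Ideal.Quotient.mk (Ideal.span {tj})))
  have hΘsurj : Function.Surjective Θ := by
    intro a
    obtain ⟨p, rfl⟩ :=
      MvPolynomial.map_surjective (ek : (F.presheaf.stalk x ⧸ Ideal.span (Set.range c)) →+* k) ek.surjective a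
    obtain ⟨q, rfl⟩ := E.symm.surjective p
    obtain ⟨b, rfl⟩ := Ideal.Quotient.mk_surjective q
    exact ⟨b, rfl⟩
  have hΘt : Θ tj = 0 := by
    change MvPolynomial.map (ek : _ →+* k) (E.symm (Ideal.Quotient.mk _ tj)) = 0
    rw [Ideal.Quotient.eq_zero_iff_mem.mpr (Ideal.mem_span_singleton_self tj), map_zero, map_zero]
  have hΘG : Θ Gj = gbar := by
    change MvPolynomial.map (ek : _ →+* k) (E.symm (Ideal.Quotient.mk _ Gj)) = gbar
    have h1 : E.symm (Ideal.Quotient.mk _ Gj) = MvPolynomial.map (Ideal.Quotient.mk (Ideal.span (Set.range c))) (dehomogenize j G) := by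
      rw [RingEquiv.symm_apply_eq, hGjdef]; exact mk_coneTransform_eq c j hc G
    rw [h1, MvPolynomial.map_map, hgbar, show (ek : _ →+* k).comp (Ideal.Quotient.mk (Ideal.span (Set.range c))) = πk from RingHom.ext hek]
  have hkerΘ : ∀ y : blowupAlgebra (Ideal.span (Set.range c)) (c j), Θ y = 0 ↔ y ∈ Ideal.span {tj} := fun y => by
    rw [← Ideal.Quotient.eq_zero_iff_mem]
    change MvPolynomial.map (ek : _ →+* k) (E.symm (Ideal.Quotient.mk _ y)) = 0 ↔ _
    constructor
    · intro h
      have h1 : E.symm (Ideal.Quotient.mk _ y) = 0 := by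
        apply MvPolynomial.map_injective (ek : (F.presheaf.stalk x ⧸ Ideal.span (Set.range c)) →+* k) ek.injective
        rw [map_zero]
        exact h
      exact (map_eq_zero_iff _ E.symm.injective).mp h1
    · intro h
      rw [h, map_zero, map_zero]
  -- a prime containing `t_j` lies over `𝔪_x`
  have hover : ∀ 𝔔 : PrimeSpectrum (blowupAlgebra (Ideal.span (Set.range c)) (c j)), tj ∈ 𝔔.asIdeal →
      𝔔.asIdeal.comap (algebraMap (F.presheaf.stalk x) (blowupAlgebra (Ideal.span (Set.range c)) (c j))) = maximalIdeal (F.presheaf.stalk x) := by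
    intro 𝔔 ht
    have hle : maximalIdeal (F.presheaf.stalk x) ≤ 𝔔.asIdeal.comap (algebraMap (F.presheaf.stalk x) (blowupAlgebra (Ideal.span (Set.range c)) (c j))) := by
      rw [← hc𝔪, Ideal.span_le]
      rintro _ ⟨l, rfl⟩
      rw [SetLike.mem_coe, Ideal.mem_comap, ← blowupAlgebra.gen_mul_algebraMap (Ideal.span (Set.range c)) (c j) (c l)
        (Ideal.subset_span ⟨l, rfl⟩)]
      exact Ideal.mul_mem_left _ _ ht
    exact ((maximalIdeal.isMaximal _).eq_of_le (Ideal.IsPrime.ne_top inferInstance) hle).symm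
  -- for each bad prime: a non-regular point of `V(Z)` over `x`, presented at `Θ⁻¹ 𝔮`
  have key : ∀ 𝔮 : PrimeSpectrum (MvPolynomial {l : Fin r // l ≠ j} k), gbar ∈ 𝔮.asIdeal →
      algebraMap (MvPolynomial {l : Fin r // l ≠ j} k) (Localization.AtPrime 𝔮.asIdeal) gbar ∈ maximalIdeal (Localization.AtPrime 𝔮.asIdeal) ^ 2 →
      ∃ (z : ↥Zi.subscheme) (hxz : υ (Zi.subschemeι z) = x) (χ : blowupAlgebra (Ideal.span (Set.range c)) (c j) →+* F'.presheaf.stalk (Zi.subschemeι z)),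
        ¬ IsRegularLocalRing (Zi.subscheme.presheaf.stalk z) ∧
        (∀ a, χ (algebraMap (F.presheaf.stalk x) (blowupAlgebra (Ideal.span (Set.range c)) (c j)) a) = (υ.stalkMap (Zi.subschemeι z)).hom
          ((F.presheaf.stalkCongr (.of_eq hxz.symm)).hom a)) ∧
        @IsLocalization.AtPrime _ _ (F'.presheaf.stalk (Zi.subschemeι z)) _ χ.toAlgebra
          (𝔮.asIdeal.comap Θ) (Ideal.comap_isPrime Θ 𝔮.asIdeal) := by
    intro 𝔮 hg𝔮 hg2
    let 𝔔 : PrimeSpectrum (blowupAlgebra (Ideal.span (Set.range c)) (c j)) := ⟨𝔮.asIdeal.comap Θ, Ideal.comap_isPrime Θ 𝔮.asIdeal⟩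
    have ht𝔔 : tj ∈ 𝔔.asIdeal := by
      change Θ tj ∈ 𝔮.asIdeal; rw [hΘt]; exact 𝔮.asIdeal.zero_mem
    have hG𝔔 : Gj ∈ 𝔔.asIdeal := by
      change Θ Gj ∈ 𝔮.asIdeal; rw [hΘG]; exact hg𝔮
    obtain ⟨x', hx', χ, e, hχ, he⟩ :=
      exists_point_presentation_of_blowupAlgebra_prime hυ x c hcJ.symm j 𝔔 (hover 𝔔 ht𝔔)
    have hsupp : x' ∈ Zi.support :=
      mem_support_carrierTrace_of_presentation hx x' hx' c hc𝔪 hc W Φ G hΦd hΦ hW hΦG hGΦ hGrad hZ j 𝔔 χ e hχ he hG𝔔 ht𝔔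
    have hrange : x' ∈ Set.range (Zi.subschemeι : _ → F') := by
      rw [Scheme.IdealSheafData.range_subschemeι]; exact hsupp
    obtain ⟨z, hz⟩ := hrange
    subst hz
    have hloc : @IsLocalization.AtPrime _ _ (F'.presheaf.stalk (Zi.subschemeι z)) _ χ.toAlgebra 𝔔.asIdeal _ :=
      isLocalization_stalk_of_ringEquiv 𝔔 _ χ e he
    refine ⟨z, hx', χ, ?_, hχ, hloc⟩
    intro hreg
    -- `Z_(x') = (K B_j) 𝒪`, `K = (G_j) + (t_j)`
    have hst := stalkIdeal_carrierTrace_of_presentation' hx _ hx' c hc𝔪 hc W Φ G hΦd hΦ hW hΦG hGΦ hGrad hZ j 𝔔 χ e hχ he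
    -- the prime `Q' = 𝔮/(ḡ_j)` of `A' = k[T]/(ḡ_j)`; the trace local ring is `L' = A'_Q'`
    have hker𝔮 : RingHom.ker (Ideal.Quotient.mk (Ideal.span {gbar})) ≤ 𝔮.asIdeal := by
      rw [Ideal.mk_ker, Ideal.span_singleton_le_iff_mem]; exact hg𝔮
    haveI hQ' : (𝔮.asIdeal.map (Ideal.Quotient.mk (Ideal.span {gbar}))).IsPrime :=
      Ideal.map_isPrime_of_surjective Ideal.Quotient.mk_surjective hker𝔮
    have hQ'c : (𝔮.asIdeal.map (Ideal.Quotient.mk (Ideal.span {gbar}))).comap (Ideal.Quotient.mk (Ideal.span {gbar})) =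
        𝔮.asIdeal := by
      rw [Ideal.comap_map_of_surjective _ Ideal.Quotient.mk_surjective, ← RingHom.ker_eq_comap_bot, sup_eq_left]
      exact hker𝔮
    obtain ⟨Λ, hΛsurj, hkerΛ'⟩ := exists_surjective_ker_eq_of_isLocalization_comap Θ hΘsurj tj Gj gbar hΘG hkerΘ
      𝔮.asIdeal hg𝔮 χ hloc
    have hkerΛ : RingHom.ker Λ = stalkIdeal Zi (Zi.subschemeι z) := by rw [hkerΛ', hst]
    -- the trace local ring is `L'`, regular iff `ḡ_j ∉ 𝔪_𝔮²` (Δ1): contradiction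
    obtain ⟨eq⟩ := nonempty_stalkSubschemeEquiv Zi z
    haveI := hreg
    have h1 : IsRegularLocalRing (F'.presheaf.stalk (Zi.subschemeι z) ⧸ stalkIdeal Zi (Zi.subschemeι z)) := IsRegularLocalRing.of_ringEquiv eq.symm
    have h2 : IsRegularLocalRing (F'.presheaf.stalk (Zi.subschemeι z) ⧸ RingHom.ker Λ) := by rw [hkerΛ]; exact h1
    have h3 : IsRegularLocalRing (Localization.AtPrime (𝔮.asIdeal.map (Ideal.Quotient.mk (Ideal.span {gbar})))) :=
      @IsRegularLocalRing.of_ringEquiv _ _ h2 _ _ (RingHom.quotientKerEquivOfSurjective hΛsurj)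
    have h4 := (isRegularLocalRing_localization_quotient_iff_notMem_sq hGj _).mp h3
    exact h4 (algebraMap_mem_maximalIdeal_sq_of_eq gbar _ _ hQ'c hg2)
  -- the injective map bad prime ↦ non-regular point
  choose z hxz χ hzreg hχ hloc using key
  have hfinS : Finite ↥({𝔮 : PrimeSpectrum (MvPolynomial {l : Fin r // l ≠ j} k) | gbar ∈ 𝔮.asIdeal ∧
      algebraMap (MvPolynomial {l : Fin r // l ≠ j} k) (Localization.AtPrime 𝔮.asIdeal) gbar ∈ maximalIdeal (Localization.AtPrime 𝔮.asIdeal) ^ 2} :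
        Set (PrimeSpectrum (MvPolynomial {l : Fin r // l ≠ j} k))) := by
    haveI : Finite ↥({z : ↥Zi.subscheme | ¬ IsRegularLocalRing (Zi.subscheme.presheaf.stalk z)} : Set ↥Zi.subscheme) :=
      hfin.to_subtype
    refine Finite.of_injective (β := ↥({z : ↥Zi.subscheme | ¬ IsRegularLocalRing (Zi.subscheme.presheaf.stalk z)} :
        Set ↥Zi.subscheme)) (fun 𝔮 => ⟨z 𝔮.1 𝔮.2.1 𝔮.2.2, hzreg 𝔮.1 𝔮.2.1 𝔮.2.2⟩) ?_
    rintro ⟨𝔮₁, h₁a, h₁b⟩ ⟨𝔮₂, h₂a, h₂b⟩ h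
    have hzz : z 𝔮₁ h₁a h₁b = z 𝔮₂ h₂a h₂b := congrArg Subtype.val h
    apply Subtype.ext
    -- the same point presented in the same chart at `Θ⁻¹ 𝔮₁` and `Θ⁻¹ 𝔮₂`: the primes agree, hence so do the `𝔮ᵢ`
    suffices hQQ : (⟨𝔮₁.asIdeal.comap Θ, Ideal.comap_isPrime Θ 𝔮₁.asIdeal⟩ : PrimeSpectrum (blowupAlgebra (Ideal.span (Set.range c)) (c j))) =
        ⟨𝔮₂.asIdeal.comap Θ, Ideal.comap_isPrime Θ 𝔮₂.asIdeal⟩ by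
      have hI : 𝔮₁.asIdeal.comap Θ = 𝔮₂.asIdeal.comap Θ := congrArg PrimeSpectrum.asIdeal hQQ
      apply PrimeSpectrum.ext
      rw [← Ideal.map_comap_of_surjective Θ hΘsurj 𝔮₁.asIdeal, hI, Ideal.map_comap_of_surjective Θ hΘsurj]
    have main : ∀ (x₁ x₂ : F') (h12 : x₁ = x₂) (hx₁ : υ x₁ = x) (hx₂ : υ x₂ = x)
        (χ₁ : blowupAlgebra (Ideal.span (Set.range c)) (c j) →+* F'.presheaf.stalk x₁) (χ₂ : blowupAlgebra (Ideal.span (Set.range c)) (c j) →+* F'.presheaf.stalk x₂),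
        (∀ a, χ₁ (algebraMap (F.presheaf.stalk x) (blowupAlgebra (Ideal.span (Set.range c)) (c j)) a) = (υ.stalkMap x₁).hom ((F.presheaf.stalkCongr (.of_eq hx₁.symm)).hom a)) →
        (∀ a, χ₂ (algebraMap (F.presheaf.stalk x) (blowupAlgebra (Ideal.span (Set.range c)) (c j)) a) = (υ.stalkMap x₂).hom ((F.presheaf.stalkCongr (.of_eq hx₂.symm)).hom a)) →
        @IsLocalization.AtPrime _ _ (F'.presheaf.stalk x₁) _ χ₁.toAlgebra (𝔮₁.asIdeal.comap Θ)
          (Ideal.comap_isPrime Θ 𝔮₁.asIdeal) →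
        @IsLocalization.AtPrime _ _ (F'.presheaf.stalk x₂) _ χ₂.toAlgebra (𝔮₂.asIdeal.comap Θ)
          (Ideal.comap_isPrime Θ 𝔮₂.asIdeal) →
        (⟨𝔮₁.asIdeal.comap Θ, Ideal.comap_isPrime Θ 𝔮₁.asIdeal⟩ : PrimeSpectrum (blowupAlgebra (Ideal.span (Set.range c)) (c j))) =
          ⟨𝔮₂.asIdeal.comap Θ, Ideal.comap_isPrime Θ 𝔮₂.asIdeal⟩ := by
      intro x₁ x₂ h12 hx₁ hx₂ χ₁ χ₂ hχ₁ hχ₂ hl₁ hl₂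
      subst h12
      exact chartPrime_eq_of_presentations hυ x₁ hx₁ c hcJ.symm j ⟨𝔮₁.asIdeal.comap Θ, Ideal.comap_isPrime Θ 𝔮₁.asIdeal⟩
        ⟨𝔮₂.asIdeal.comap Θ, Ideal.comap_isPrime Θ 𝔮₂.asIdeal⟩ χ₁ χ₂ hχ₁ hχ₂ hl₁ hl₂
    exact main _ _ (congrArg (fun P : ↥Zi.subscheme => (Zi.subschemeι P : F')) hzz) (hxz 𝔮₁ h₁a h₁b) (hxz 𝔮₂ h₂a h₂b)
      _ _ (hχ 𝔮₁ h₁a h₁b) (hχ 𝔮₂ h₂a h₂b) (hloc 𝔮₁ h₁a h₁b) (hloc 𝔮₂ h₂a h₂b)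
  exact Set.toFinite _

end Finite

end Summit.ResolutionOfSingularities.ResolutionOfSingularities.Cruxes.EquisingularLiftNat.Sections

end
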